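import Summits.CriticalPhenomena.PercolationContinuityZ3.Theorems.PercNearOneGluingAdditiveGluingThreeRelaysAssembly
import Summits.CriticalPhenomena.PercolationContinuityZ3.Theorems.PercNearOneGluingAdditiveGluingExchangeChart
import Summits.CriticalPhenomena.PercolationContinuityZ3.Theorems.PercNearOneGluingAdditiveGluingKnThm2Refined
import Summits.CriticalPhenomena.PercolationContinuityZ3.Theorems.PercNearOneGluingAdditiveGluingChartB
import Summits.CriticalPhenomena.PercolationContinuityZ3.Theorems.PercNearOneGluingAdditiveGluingChartC
import Summits.CriticalPhenomena.PercolationContinuityZ3.Theorems.PercNearOneGluingAdditiveGluingChartD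
import HarnessLib

/-!
# Crux `PercNearOneGluing.AdditiveGluing` (stmt-CriticalPhenomena-4576): the three-relay case REDUCED TO A NAMED RESIDUAL
# (seat (d) exchange-certificate form, gen 3 — "every closed case a landed lemma, the residual named precisely")

Support file (`--supports stmt-CriticalPhenomena-4576`); no definitions, no named facts, no sorries.  CONDITIONAL results: the
hypothesis `hRES` (the residual) is spelled out.

Setting: `μ = prodBernoulli w`, observer `o`, target `b`, three distinct relays with `a₃` worst, `E = (o↔a₁ ∪ o↔a₂ ∪ o↔a₃) ∖ o↔b`.
The three-relay E-form `μ(E) ≤ μ(a₃ ↮ b)` (= `AdditiveGluing` at the minimiser for three relays) is PROVED in the tree in the cases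
* TRIVIAL `τ₃ ≤ τ_o` (`E ⊆ o ↮ b`);  * GOOD `m₃ ≤ m₁₂` (Kozma–Nitzan Theorem 2, `knThm2_core`);
* the SINGLE-EXCHANGE charts (G1), (G2) (`eform3_exch₁/₂`, this seat);
* the two-weak-singles charts B, C, D of the refined-coordinate atlas (`eform3_chartB/C/D`, seat (d) gen 2);
* the Kozma–Nitzan Theorem-2 certificate with room (T1) in the bad region (`knThm2_region_eform`, deep seat r2);
* the refined Kozma–Nitzan certificate (`knThm2_refined_eform`, seat (d) gen 2).
`eform3_of_residual` performs exactly this case split (after the w.l.o.g. `τ₁ ≤ τ₂`), so the three-relay case follows from the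
RESIDUAL `hRES`: the E-form on those instances of the nontrivial bad region on which ALL the listed certificates fail.
Census of this seat (exact partition engine, n ≤ 9, evidence EXCHCERT-g3.md / kit j039541 on the item): (G1) ∨ (G2) alone holds on all
6 961 SAMPLED nontrivial-bad instances; adversarial annealing inside the region finds instances with ¬(G1) ∧ ¬(G2) (hub-pair
configurations near a four-way tie `τ_o ≈ τ₁ ≈ τ₂ ≈ τ₃`), all certified by (T1); no instance satisfying `hRES`'s antecedent
was met by this seat (kit campaign j039541 hunts for one at scale; its summary is attached to the item).
Companion file `…ExchangeResidualAssembly`: the E-form for any three relays, `AdditiveGluing` for `(A.erase b).card ≤ 3`, and the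
registered stub `stub_threeRelaysFullTieAllBad_pl` of the official skeleton, all from `hRES`.
[cite: KozmaNitzan2024, Theorem 2 (§3.1, pp. 8–9), Theorem 3 and Lemma 4 (pp. 9–12), Lemma 3 (pp. 6–7), Conjecture 1 (p. 3)]
-/

namespace Summit.CriticalPhenomena.PercolationContinuityZ3.Theorems

open MeasureTheory Set Literature.Probability.LatticeModels Literature.Probability.Percolation

noncomputable section
open Classical

variable {n : ℕ}

/-- Reordering of a four-fold intersection of complements (the refined separation events are written in several orders in the
atlas charts). [folklore] -/
theorem res_swapN (P Q R S : Set (BondConfig (Fin n))) : Qᶜ ∩ Pᶜ ∩ (Sᶜ ∩ Rᶜ) = Pᶜ ∩ Qᶜ ∩ (Rᶜ ∩ Sᶜ) := by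
  ext ω; simp only [Set.mem_inter_iff, Set.mem_compl_iff]; tauto

/-- **The ordered three-relay E-form from the residual** (`a₃` worst, `τ₁ ≤ τ₂`, all of `o, a₁, a₂, a₃` distinct): case split
trivial | good (KN Thm 2) | (G1) | (G2) | chart B | chart C | chart D | (T1) | refined KN | residual.
[cite: KozmaNitzan2024, Theorem 2 (§3.1, pp. 8–9), Lemma 3 (pp. 6–7)] -/
theorem eform3_of_residual_ordered
    (hRES : ∀ (n : ℕ) (w : Sym2 (Fin n) → unitInterval) (o b a₁ a₂ a₃ : Fin n),
      a₁ ≠ a₂ → a₁ ≠ a₃ → a₂ ≠ a₃ → o ≠ a₁ → o ≠ a₂ → o ≠ a₃ →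
      -- `a₃` worst, `τ₁ ≤ τ₂` (w.l.o.g.), nontrivial, bad
      (prodBernoulli w).real (openConn a₃ b) ≤ (prodBernoulli w).real (openConn a₁ b) →
      (prodBernoulli w).real (openConn a₁ b) ≤ (prodBernoulli w).real (openConn a₂ b) →
      (prodBernoulli w).real (openConn o b) < (prodBernoulli w).real (openConn a₃ b) →
      (prodBernoulli w).real (openConn b a₁ ∩ openConn b a₂ ∩ (openConn b a₃)ᶜ) <
        (prodBernoulli w).real (openConn b a₃ ∩ (openConn b a₁)ᶜ ∩ (openConn b a₂)ᶜ) →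
      -- the single-exchange charts fail: ¬(G1), ¬(G2)
      (prodBernoulli w).real (openConn o a₁ ∩ (openConn o a₂)ᶜ ∩ (openConn o a₃)ᶜ ∩ openConn a₁ b) + (prodBernoulli w).real ((openConn o a₁ ∪ openConn o a₂ ∪ openConn o a₃)ᶜ ∩ (openConn a₃ b)ᶜ) <
        (prodBernoulli w).real (openConn o a₁ ∩ (openConn o a₂)ᶜ ∩ (openConn o a₃)ᶜ ∩ openConn a₃ b) →
      (prodBernoulli w).real (openConn o a₂ ∩ (openConn o a₁)ᶜ ∩ (openConn o a₃)ᶜ ∩ openConn a₂ b) + (prodBernoulli w).real ((openConn o a₁ ∪ openConn o a₂ ∪ openConn o a₃)ᶜ ∩ (openConn a₃ b)ᶜ) <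
        (prodBernoulli w).real (openConn o a₂ ∩ (openConn o a₁)ᶜ ∩ (openConn o a₃)ᶜ ∩ openConn a₃ b) →
      -- the two-weak-singles charts B, C, D fail (at most one single refined attachment is `≤ 1/2`)
      ¬ (2 * (prodBernoulli w).real ((openConn a₁ a₂)ᶜ ∩ (openConn a₁ a₃)ᶜ ∩ ((openConn o a₂)ᶜ ∩ (openConn o a₃)ᶜ) ∩ openConn a₁ o) ≤ (prodBernoulli w).real ((openConn a₁ a₂)ᶜ ∩ (openConn a₁ a₃)ᶜ ∩ ((openConn o a₂)ᶜ ∩ (openConn o a₃)ᶜ)) ∧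
         2 * (prodBernoulli w).real ((openConn a₂ a₁)ᶜ ∩ (openConn a₂ a₃)ᶜ ∩ ((openConn o a₁)ᶜ ∩ (openConn o a₃)ᶜ) ∩ openConn a₂ o) ≤ (prodBernoulli w).real ((openConn a₂ a₁)ᶜ ∩ (openConn a₂ a₃)ᶜ ∩ ((openConn o a₁)ᶜ ∩ (openConn o a₃)ᶜ))) →
      ¬ (2 * (prodBernoulli w).real ((openConn a₂ a₁)ᶜ ∩ (openConn a₂ a₃)ᶜ ∩ ((openConn o a₁)ᶜ ∩ (openConn o a₃)ᶜ) ∩ openConn a₂ o) ≤ (prodBernoulli w).real ((openConn a₂ a₁)ᶜ ∩ (openConn a₂ a₃)ᶜ ∩ ((openConn o a₁)ᶜ ∩ (openConn o a₃)ᶜ)) ∧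
         2 * (prodBernoulli w).real ((openConn a₃ a₁)ᶜ ∩ (openConn a₃ a₂)ᶜ ∩ ((openConn o a₁)ᶜ ∩ (openConn o a₂)ᶜ) ∩ openConn a₃ o) ≤ (prodBernoulli w).real ((openConn a₃ a₁)ᶜ ∩ (openConn a₃ a₂)ᶜ ∩ ((openConn o a₁)ᶜ ∩ (openConn o a₂)ᶜ))) →
      ¬ (2 * (prodBernoulli w).real ((openConn a₁ a₂)ᶜ ∩ (openConn a₁ a₃)ᶜ ∩ ((openConn o a₂)ᶜ ∩ (openConn o a₃)ᶜ) ∩ openConn a₁ o) ≤ (prodBernoulli w).real ((openConn a₁ a₂)ᶜ ∩ (openConn a₁ a₃)ᶜ ∩ ((openConn o a₂)ᶜ ∩ (openConn o a₃)ᶜ)) ∧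
         2 * (prodBernoulli w).real ((openConn a₃ a₁)ᶜ ∩ (openConn a₃ a₂)ᶜ ∩ ((openConn o a₁)ᶜ ∩ (openConn o a₂)ᶜ) ∩ openConn a₃ o) ≤ (prodBernoulli w).real ((openConn a₃ a₁)ᶜ ∩ (openConn a₃ a₂)ᶜ ∩ ((openConn o a₁)ᶜ ∩ (openConn o a₂)ᶜ))) →
      -- the Kozma–Nitzan Theorem-2 certificate with room (T1) fails
      ¬ (0 ≤
      (prodBernoulli w).real ((openConn a₁ a₃)ᶜ ∩ (openConn a₂ a₃)ᶜ ∩ (openConn a₁ o ∪ openConn a₂ o)) *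
            (prodBernoulli w).real ((openConn a₁ a₂)ᶜ ∩ (openConn a₁ a₃)ᶜ : Set (BondConfig (Fin n))) *
            (prodBernoulli w).real ((openConn a₂ a₁)ᶜ ∩ (openConn a₂ a₃)ᶜ : Set (BondConfig (Fin n))) *
          ((prodBernoulli w).real ((openConn a₁ a₃)ᶜ ∩ (openConn a₂ a₃)ᶜ ∩ (openConn a₁ b ∩ openConn a₂ b)) -
            (prodBernoulli w).real ((openConn a₁ a₃)ᶜ ∩ (openConn a₂ a₃)ᶜ ∩ openConn a₃ b)) +
        (prodBernoulli w).real ((openConn a₁ a₂)ᶜ ∩ (openConn a₁ a₃)ᶜ ∩ openConn a₁ o) *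
            (prodBernoulli w).real ((openConn a₁ a₃)ᶜ ∩ (openConn a₂ a₃)ᶜ : Set (BondConfig (Fin n))) *
            (prodBernoulli w).real ((openConn a₂ a₁)ᶜ ∩ (openConn a₂ a₃)ᶜ : Set (BondConfig (Fin n))) *
          ((prodBernoulli w).real ((openConn a₁ a₂)ᶜ ∩ (openConn a₁ a₃)ᶜ ∩ openConn a₁ b) -
            (prodBernoulli w).real ((openConn a₁ a₂)ᶜ ∩ (openConn a₁ a₃)ᶜ ∩ (openConn a₂ b ∩ openConn a₃ b))) +
        (prodBernoulli w).real ((openConn a₂ a₁)ᶜ ∩ (openConn a₂ a₃)ᶜ ∩ openConn a₂ o) *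
            (prodBernoulli w).real ((openConn a₁ a₃)ᶜ ∩ (openConn a₂ a₃)ᶜ : Set (BondConfig (Fin n))) *
            (prodBernoulli w).real ((openConn a₁ a₂)ᶜ ∩ (openConn a₁ a₃)ᶜ : Set (BondConfig (Fin n))) *
          ((prodBernoulli w).real ((openConn a₂ a₁)ᶜ ∩ (openConn a₂ a₃)ᶜ ∩ openConn a₂ b) -
            (prodBernoulli w).real ((openConn a₂ a₁)ᶜ ∩ (openConn a₂ a₃)ᶜ ∩ (openConn a₁ b ∩ openConn a₃ b))) +
        (prodBernoulli w).real ((openConn a₁ a₂)ᶜ ∩ (openConn a₁ a₃)ᶜ : Set (BondConfig (Fin n))) *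
            (prodBernoulli w).real ((openConn a₂ a₁)ᶜ ∩ (openConn a₂ a₃)ᶜ : Set (BondConfig (Fin n))) *
            (prodBernoulli w).real ((openConn a₁ a₃)ᶜ ∩ (openConn a₂ a₃)ᶜ : Set (BondConfig (Fin n))) *
          (prodBernoulli w).real
            ((openConn o a₁ ∪ openConn o a₂ ∪ openConn o a₃)ᶜ ∩ (openConn a₃ b)ᶜ : Set (BondConfig (Fin n)))) →
      -- the refined Kozma–Nitzan certificate (source sets with the observer adjoined) fails
      ¬ (0 < (prodBernoulli w).real
          ((openConn a₁ a₃)ᶜ ∩ (openConn a₂ a₃)ᶜ ∩ (openConn o a₃)ᶜ : Set (BondConfig (Fin n))) ∧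
        0 < (prodBernoulli w).real
          ((openConn a₁ a₂)ᶜ ∩ (openConn a₁ a₃)ᶜ ∩ ((openConn o a₂)ᶜ ∩ (openConn o a₃)ᶜ) : Set (BondConfig (Fin n))) ∧
        0 < (prodBernoulli w).real
          ((openConn a₂ a₁)ᶜ ∩ (openConn a₂ a₃)ᶜ ∩ ((openConn o a₁)ᶜ ∩ (openConn o a₃)ᶜ) : Set (BondConfig (Fin n))) ∧
        0 ≤
        (prodBernoulli w).real ((openConn a₁ a₂)ᶜ ∩ (openConn a₁ a₃)ᶜ ∩ ((openConn o a₂)ᶜ ∩ (openConn o a₃)ᶜ) : Set (BondConfig (Fin n)))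
          * (prodBernoulli w).real ((openConn a₂ a₁)ᶜ ∩ (openConn a₂ a₃)ᶜ ∩ ((openConn o a₁)ᶜ ∩ (openConn o a₃)ᶜ) : Set (BondConfig (Fin n)))
          * ((prodBernoulli w).real ((openConn a₁ a₃)ᶜ ∩ (openConn a₂ a₃)ᶜ ∩ (openConn o a₃)ᶜ ∩ (openConn a₁ o ∪ openConn a₂ o))
            * ((prodBernoulli w).real ((openConn a₁ a₃)ᶜ ∩ (openConn a₂ a₃)ᶜ ∩ (openConn o a₃)ᶜ ∩ (openConn a₁ b ∩ openConn a₂ b))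
              - (prodBernoulli w).real ((openConn a₁ a₃)ᶜ ∩ (openConn a₂ a₃)ᶜ ∩ (openConn o a₃)ᶜ ∩ openConn a₃ b)))
      + (prodBernoulli w).real ((openConn a₂ a₁)ᶜ ∩ (openConn a₂ a₃)ᶜ ∩ ((openConn o a₁)ᶜ ∩ (openConn o a₃)ᶜ) : Set (BondConfig (Fin n)))
          * (prodBernoulli w).real ((openConn a₁ a₃)ᶜ ∩ (openConn a₂ a₃)ᶜ ∩ (openConn o a₃)ᶜ : Set (BondConfig (Fin n)))
          * ((prodBernoulli w).real ((openConn a₁ a₂)ᶜ ∩ (openConn a₁ a₃)ᶜ ∩ ((openConn o a₂)ᶜ ∩ (openConn o a₃)ᶜ) ∩ openConn a₁ o)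
            * ((prodBernoulli w).real ((openConn a₁ a₂)ᶜ ∩ (openConn a₁ a₃)ᶜ ∩ ((openConn o a₂)ᶜ ∩ (openConn o a₃)ᶜ) ∩ openConn a₁ b)
              - (prodBernoulli w).real ((openConn a₁ a₂)ᶜ ∩ (openConn a₁ a₃)ᶜ ∩ ((openConn o a₂)ᶜ ∩ (openConn o a₃)ᶜ) ∩ (openConn a₂ b ∩ openConn a₃ b))))
      + (prodBernoulli w).real ((openConn a₁ a₂)ᶜ ∩ (openConn a₁ a₃)ᶜ ∩ ((openConn o a₂)ᶜ ∩ (openConn o a₃)ᶜ) : Set (BondConfig (Fin n)))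
          * (prodBernoulli w).real ((openConn a₁ a₃)ᶜ ∩ (openConn a₂ a₃)ᶜ ∩ (openConn o a₃)ᶜ : Set (BondConfig (Fin n)))
          * ((prodBernoulli w).real ((openConn a₂ a₁)ᶜ ∩ (openConn a₂ a₃)ᶜ ∩ ((openConn o a₁)ᶜ ∩ (openConn o a₃)ᶜ) ∩ openConn a₂ o)
            * ((prodBernoulli w).real ((openConn a₂ a₁)ᶜ ∩ (openConn a₂ a₃)ᶜ ∩ ((openConn o a₁)ᶜ ∩ (openConn o a₃)ᶜ) ∩ openConn a₂ b)
              - (prodBernoulli w).real ((openConn a₂ a₁)ᶜ ∩ (openConn a₂ a₃)ᶜ ∩ ((openConn o a₁)ᶜ ∩ (openConn o a₃)ᶜ) ∩ (openConn a₁ b ∩ openConn a₃ b))))) →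
      (prodBernoulli w).real ((openConn o a₁ ∪ openConn o a₂ ∪ openConn o a₃) \ openConn o b) ≤
        (prodBernoulli w).real ((openConn a₃ b)ᶜ))
    (w : Sym2 (Fin n) → unitInterval) (o b a₁ a₂ a₃ : Fin n)
    (h12 : a₁ ≠ a₂) (h13 : a₁ ≠ a₃) (h23 : a₂ ≠ a₃) (ho1 : o ≠ a₁) (ho2 : o ≠ a₂) (ho3 : o ≠ a₃)
    (hτ31 : (prodBernoulli w).real (openConn a₃ b) ≤ (prodBernoulli w).real (openConn a₁ b))
    (hτ32 : (prodBernoulli w).real (openConn a₃ b) ≤ (prodBernoulli w).real (openConn a₂ b))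
    (hτ12 : (prodBernoulli w).real (openConn a₁ b) ≤ (prodBernoulli w).real (openConn a₂ b)) :
    (prodBernoulli w).real ((openConn o a₁ ∪ openConn o a₂ ∪ openConn o a₃) \ openConn o b) ≤
      (prodBernoulli w).real ((openConn a₃ b)ᶜ) := by
  have hm : ∀ s : Set (BondConfig (Fin n)), MeasurableSet s := fun _ => MeasurableSet.of_discrete
  have hc3 : (prodBernoulli w).real ((openConn a₃ b)ᶜ : Set (BondConfig (Fin n))) =
      1 - (prodBernoulli w).real (openConn a₃ b : Set (BondConfig (Fin n))) := probReal_compl_eq_one_sub (hm _)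
  by_cases hob : (prodBernoulli w).real (openConn a₃ b) ≤ (prodBernoulli w).real (openConn o b)
  · -- trivial region
    have hco : (prodBernoulli w).real ((openConn o b)ᶜ : Set (BondConfig (Fin n))) =
        1 - (prodBernoulli w).real (openConn o b : Set (BondConfig (Fin n))) := probReal_compl_eq_one_sub (hm _)
    have hsub : (prodBernoulli w).real ((openConn o a₁ ∪ openConn o a₂ ∪ openConn o a₃) \ openConn o b) ≤
        (prodBernoulli w).real ((openConn o b)ᶜ : Set (BondConfig (Fin n))) :=
      measureReal_mono (fun ω hω => hω.2)
    linarith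
  push Not at hob
  by_cases hgood : (prodBernoulli w).real (openConn b a₃ ∩ (openConn b a₁)ᶜ ∩ (openConn b a₂)ᶜ) ≤
      (prodBernoulli w).real (openConn b a₁ ∩ openConn b a₂ ∩ (openConn b a₃)ᶜ)
  · -- good region: Kozma–Nitzan Theorem 2
    have hX := knThm2_core stub_bhkSets.1 stub_bhkSets.2 (stub_knLemma2 stub_bhkSets) w o b a₁ a₂ a₃
      h12 h13 h23 hτ31 hτ32 hgood
    have h1 := measureReal_inter_add_sdiff (μ := prodBernoulli w)
      (s := openConn o a₁ ∪ openConn o a₂ ∪ openConn o a₃) (hm (openConn o b))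
    have h2 := measureReal_inter_add_sdiff (μ := prodBernoulli w)
      (s := openConn o a₁ ∪ openConn o a₂ ∪ openConn o a₃) (hm (openConn a₃ b))
    have h3 : (prodBernoulli w).real ((openConn o a₁ ∪ openConn o a₂ ∪ openConn o a₃) \ openConn a₃ b) ≤
        (prodBernoulli w).real ((openConn a₃ b)ᶜ : Set (BondConfig (Fin n))) :=
      measureReal_mono fun ω hω => hω.2
    linarith
  push Not at hgood
  -- single-exchange charts
  by_cases hG1 : (prodBernoulli w).real (openConn o a₁ ∩ (openConn o a₂)ᶜ ∩ (openConn o a₃)ᶜ ∩ openConn a₃ b) ≤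
      (prodBernoulli w).real (openConn o a₁ ∩ (openConn o a₂)ᶜ ∩ (openConn o a₃)ᶜ ∩ openConn a₁ b) + (prodBernoulli w).real ((openConn o a₁ ∪ openConn o a₂ ∪ openConn o a₃)ᶜ ∩ (openConn a₃ b)ᶜ)
  · exact eform3_exch₁ w o b a₁ a₂ a₃ hτ32 hG1
  push Not at hG1
  by_cases hG2 : (prodBernoulli w).real (openConn o a₂ ∩ (openConn o a₁)ᶜ ∩ (openConn o a₃)ᶜ ∩ openConn a₃ b) ≤
      (prodBernoulli w).real (openConn o a₂ ∩ (openConn o a₁)ᶜ ∩ (openConn o a₃)ᶜ ∩ openConn a₂ b) + (prodBernoulli w).real ((openConn o a₁ ∪ openConn o a₂ ∪ openConn o a₃)ᶜ ∩ (openConn a₃ b)ᶜ)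
  · exact eform3_exch₂ w o b a₁ a₂ a₃ hτ31 hG2
  push Not at hG2
  -- two-weak-singles charts B, C, D
  by_cases hB : 2 * (prodBernoulli w).real ((openConn a₁ a₂)ᶜ ∩ (openConn a₁ a₃)ᶜ ∩ ((openConn o a₂)ᶜ ∩ (openConn o a₃)ᶜ) ∩ openConn a₁ o) ≤ (prodBernoulli w).real ((openConn a₁ a₂)ᶜ ∩ (openConn a₁ a₃)ᶜ ∩ ((openConn o a₂)ᶜ ∩ (openConn o a₃)ᶜ)) ∧
      2 * (prodBernoulli w).real ((openConn a₂ a₁)ᶜ ∩ (openConn a₂ a₃)ᶜ ∩ ((openConn o a₁)ᶜ ∩ (openConn o a₃)ᶜ) ∩ openConn a₂ o) ≤ (prodBernoulli w).real ((openConn a₂ a₁)ᶜ ∩ (openConn a₂ a₃)ᶜ ∩ ((openConn o a₁)ᶜ ∩ (openConn o a₃)ᶜ))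
  · exact eform3_chartB w o b a₁ a₂ a₃ h12 h13 h23 ho1 ho2 ho3 hτ31 hτ32 hB.1 hB.2
  by_cases hC : 2 * (prodBernoulli w).real ((openConn a₂ a₁)ᶜ ∩ (openConn a₂ a₃)ᶜ ∩ ((openConn o a₁)ᶜ ∩ (openConn o a₃)ᶜ) ∩ openConn a₂ o) ≤ (prodBernoulli w).real ((openConn a₂ a₁)ᶜ ∩ (openConn a₂ a₃)ᶜ ∩ ((openConn o a₁)ᶜ ∩ (openConn o a₃)ᶜ)) ∧
      2 * (prodBernoulli w).real ((openConn a₃ a₁)ᶜ ∩ (openConn a₃ a₂)ᶜ ∩ ((openConn o a₁)ᶜ ∩ (openConn o a₂)ᶜ) ∩ openConn a₃ o) ≤ (prodBernoulli w).real ((openConn a₃ a₁)ᶜ ∩ (openConn a₃ a₂)ᶜ ∩ ((openConn o a₁)ᶜ ∩ (openConn o a₂)ᶜ))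
  · have e2 := res_swapN (openConn a₂ a₁ : Set (BondConfig (Fin n))) (openConn a₂ a₃) (openConn o a₁) (openConn o a₃)
    have e3 := res_swapN (openConn a₃ a₁ : Set (BondConfig (Fin n))) (openConn a₃ a₂) (openConn o a₁) (openConn o a₂)
    have hA₂ := hC.1
    have hA₃ := hC.2
    rw [← e2] at hA₂
    rw [← e3] at hA₃
    exact eform3_chartC w o b a₁ a₂ a₃ h12 h13 h23 ho1 ho2 ho3 hτ31 hτ12 hA₂ hA₃
  by_cases hD : 2 * (prodBernoulli w).real ((openConn a₁ a₂)ᶜ ∩ (openConn a₁ a₃)ᶜ ∩ ((openConn o a₂)ᶜ ∩ (openConn o a₃)ᶜ) ∩ openConn a₁ o) ≤ (prodBernoulli w).real ((openConn a₁ a₂)ᶜ ∩ (openConn a₁ a₃)ᶜ ∩ ((openConn o a₂)ᶜ ∩ (openConn o a₃)ᶜ)) ∧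
      2 * (prodBernoulli w).real ((openConn a₃ a₁)ᶜ ∩ (openConn a₃ a₂)ᶜ ∩ ((openConn o a₁)ᶜ ∩ (openConn o a₂)ᶜ) ∩ openConn a₃ o) ≤ (prodBernoulli w).real ((openConn a₃ a₁)ᶜ ∩ (openConn a₃ a₂)ᶜ ∩ ((openConn o a₁)ᶜ ∩ (openConn o a₂)ᶜ))
  · have e1 := res_swapN (openConn a₁ a₂ : Set (BondConfig (Fin n))) (openConn a₁ a₃) (openConn o a₂) (openConn o a₃)
    have hA₁ := hD.1
    rw [← e1] at hA₁
    exact eform3_chartD w o b a₁ a₂ a₃ h12 h13 h23 ho1 ho2 ho3 hτ31 hτ32 hτ12 hA₁ hD.2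
  -- the Kozma–Nitzan certificate with room (T1)
  by_cases hT : 0 ≤
      (prodBernoulli w).real ((openConn a₁ a₃)ᶜ ∩ (openConn a₂ a₃)ᶜ ∩ (openConn a₁ o ∪ openConn a₂ o)) *
            (prodBernoulli w).real ((openConn a₁ a₂)ᶜ ∩ (openConn a₁ a₃)ᶜ : Set (BondConfig (Fin n))) *
            (prodBernoulli w).real ((openConn a₂ a₁)ᶜ ∩ (openConn a₂ a₃)ᶜ : Set (BondConfig (Fin n))) *
          ((prodBernoulli w).real ((openConn a₁ a₃)ᶜ ∩ (openConn a₂ a₃)ᶜ ∩ (openConn a₁ b ∩ openConn a₂ b)) -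
            (prodBernoulli w).real ((openConn a₁ a₃)ᶜ ∩ (openConn a₂ a₃)ᶜ ∩ openConn a₃ b)) +
        (prodBernoulli w).real ((openConn a₁ a₂)ᶜ ∩ (openConn a₁ a₃)ᶜ ∩ openConn a₁ o) *
            (prodBernoulli w).real ((openConn a₁ a₃)ᶜ ∩ (openConn a₂ a₃)ᶜ : Set (BondConfig (Fin n))) *
            (prodBernoulli w).real ((openConn a₂ a₁)ᶜ ∩ (openConn a₂ a₃)ᶜ : Set (BondConfig (Fin n))) *
          ((prodBernoulli w).real ((openConn a₁ a₂)ᶜ ∩ (openConn a₁ a₃)ᶜ ∩ openConn a₁ b) -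
            (prodBernoulli w).real ((openConn a₁ a₂)ᶜ ∩ (openConn a₁ a₃)ᶜ ∩ (openConn a₂ b ∩ openConn a₃ b))) +
        (prodBernoulli w).real ((openConn a₂ a₁)ᶜ ∩ (openConn a₂ a₃)ᶜ ∩ openConn a₂ o) *
            (prodBernoulli w).real ((openConn a₁ a₃)ᶜ ∩ (openConn a₂ a₃)ᶜ : Set (BondConfig (Fin n))) *
            (prodBernoulli w).real ((openConn a₁ a₂)ᶜ ∩ (openConn a₁ a₃)ᶜ : Set (BondConfig (Fin n))) *
          ((prodBernoulli w).real ((openConn a₂ a₁)ᶜ ∩ (openConn a₂ a₃)ᶜ ∩ openConn a₂ b) -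
            (prodBernoulli w).real ((openConn a₂ a₁)ᶜ ∩ (openConn a₂ a₃)ᶜ ∩ (openConn a₁ b ∩ openConn a₃ b))) +
        (prodBernoulli w).real ((openConn a₁ a₂)ᶜ ∩ (openConn a₁ a₃)ᶜ : Set (BondConfig (Fin n))) *
            (prodBernoulli w).real ((openConn a₂ a₁)ᶜ ∩ (openConn a₂ a₃)ᶜ : Set (BondConfig (Fin n))) *
            (prodBernoulli w).real ((openConn a₁ a₃)ᶜ ∩ (openConn a₂ a₃)ᶜ : Set (BondConfig (Fin n))) *
          (prodBernoulli w).real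
            ((openConn o a₁ ∪ openConn o a₂ ∪ openConn o a₃)ᶜ ∩ (openConn a₃ b)ᶜ : Set (BondConfig (Fin n)))
  · have hbad := hgood
    rw [knThm2_m3, knThm2_m12] at hbad
    exact knThm2_region_eform stub_bhkSets.1 stub_bhkSets.2 w o b a₁ a₂ a₃ h12 h13 h23 hτ31 hτ32 hbad hT
  -- the refined Kozma–Nitzan certificate
  by_cases hRF : 0 < (prodBernoulli w).real
          ((openConn a₁ a₃)ᶜ ∩ (openConn a₂ a₃)ᶜ ∩ (openConn o a₃)ᶜ : Set (BondConfig (Fin n))) ∧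
        0 < (prodBernoulli w).real
          ((openConn a₁ a₂)ᶜ ∩ (openConn a₁ a₃)ᶜ ∩ ((openConn o a₂)ᶜ ∩ (openConn o a₃)ᶜ) : Set (BondConfig (Fin n))) ∧
        0 < (prodBernoulli w).real
          ((openConn a₂ a₁)ᶜ ∩ (openConn a₂ a₃)ᶜ ∩ ((openConn o a₁)ᶜ ∩ (openConn o a₃)ᶜ) : Set (BondConfig (Fin n))) ∧
        0 ≤
        (prodBernoulli w).real ((openConn a₁ a₂)ᶜ ∩ (openConn a₁ a₃)ᶜ ∩ ((openConn o a₂)ᶜ ∩ (openConn o a₃)ᶜ) : Set (BondConfig (Fin n)))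
          * (prodBernoulli w).real ((openConn a₂ a₁)ᶜ ∩ (openConn a₂ a₃)ᶜ ∩ ((openConn o a₁)ᶜ ∩ (openConn o a₃)ᶜ) : Set (BondConfig (Fin n)))
          * ((prodBernoulli w).real ((openConn a₁ a₃)ᶜ ∩ (openConn a₂ a₃)ᶜ ∩ (openConn o a₃)ᶜ ∩ (openConn a₁ o ∪ openConn a₂ o))
            * ((prodBernoulli w).real ((openConn a₁ a₃)ᶜ ∩ (openConn a₂ a₃)ᶜ ∩ (openConn o a₃)ᶜ ∩ (openConn a₁ b ∩ openConn a₂ b))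
              - (prodBernoulli w).real ((openConn a₁ a₃)ᶜ ∩ (openConn a₂ a₃)ᶜ ∩ (openConn o a₃)ᶜ ∩ openConn a₃ b)))
      + (prodBernoulli w).real ((openConn a₂ a₁)ᶜ ∩ (openConn a₂ a₃)ᶜ ∩ ((openConn o a₁)ᶜ ∩ (openConn o a₃)ᶜ) : Set (BondConfig (Fin n)))
          * (prodBernoulli w).real ((openConn a₁ a₃)ᶜ ∩ (openConn a₂ a₃)ᶜ ∩ (openConn o a₃)ᶜ : Set (BondConfig (Fin n)))
          * ((prodBernoulli w).real ((openConn a₁ a₂)ᶜ ∩ (openConn a₁ a₃)ᶜ ∩ ((openConn o a₂)ᶜ ∩ (openConn o a₃)ᶜ) ∩ openConn a₁ o)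
            * ((prodBernoulli w).real ((openConn a₁ a₂)ᶜ ∩ (openConn a₁ a₃)ᶜ ∩ ((openConn o a₂)ᶜ ∩ (openConn o a₃)ᶜ) ∩ openConn a₁ b)
              - (prodBernoulli w).real ((openConn a₁ a₂)ᶜ ∩ (openConn a₁ a₃)ᶜ ∩ ((openConn o a₂)ᶜ ∩ (openConn o a₃)ᶜ) ∩ (openConn a₂ b ∩ openConn a₃ b))))
      + (prodBernoulli w).real ((openConn a₁ a₂)ᶜ ∩ (openConn a₁ a₃)ᶜ ∩ ((openConn o a₂)ᶜ ∩ (openConn o a₃)ᶜ) : Set (BondConfig (Fin n)))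
          * (prodBernoulli w).real ((openConn a₁ a₃)ᶜ ∩ (openConn a₂ a₃)ᶜ ∩ (openConn o a₃)ᶜ : Set (BondConfig (Fin n)))
          * ((prodBernoulli w).real ((openConn a₂ a₁)ᶜ ∩ (openConn a₂ a₃)ᶜ ∩ ((openConn o a₁)ᶜ ∩ (openConn o a₃)ᶜ) ∩ openConn a₂ o)
            * ((prodBernoulli w).real ((openConn a₂ a₁)ᶜ ∩ (openConn a₂ a₃)ᶜ ∩ ((openConn o a₁)ᶜ ∩ (openConn o a₃)ᶜ) ∩ openConn a₂ b)
              - (prodBernoulli w).real ((openConn a₂ a₁)ᶜ ∩ (openConn a₂ a₃)ᶜ ∩ ((openConn o a₁)ᶜ ∩ (openConn o a₃)ᶜ) ∩ (openConn a₁ b ∩ openConn a₃ b))))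
  · obtain ⟨hP₁₂, hP₁, hP₂, hcert⟩ := hRF
    have h := knThm2_refined_eform w o b a₁ a₂ a₃ (1 - (prodBernoulli w).real (openConn a₃ b)) h12 h13 h23 ho1 ho2 ho3
      hP₁₂ hP₁ hP₂ hcert (by linarith)
    linarith
  -- the residual
  exact hRES n w o b a₁ a₂ a₃ h12 h13 h23 ho1 ho2 ho3 hτ31 hτ12 hob hgood hG1 hG2 hB hC hD hT hRF

/-- **The three-relay E-form from the residual** (`a₃` worst, no order between `a₁, a₂`, `o` arbitrary): `μ(E) ≤ t` whenever
`1 − t ≤ τ₃`.  If `o` is as reliable as `a₃` (in particular if `o` is a relay) the trivial bound applies; otherwise order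
`a₁, a₂` and use `eform3_of_residual_ordered`. [cite: KozmaNitzan2024, Theorem 2 (§3.1, pp. 8–9)] -/
theorem eform3_of_residual
    (hRES : ∀ (n : ℕ) (w : Sym2 (Fin n) → unitInterval) (o b a₁ a₂ a₃ : Fin n),
      a₁ ≠ a₂ → a₁ ≠ a₃ → a₂ ≠ a₃ → o ≠ a₁ → o ≠ a₂ → o ≠ a₃ →
      -- `a₃` worst, `τ₁ ≤ τ₂` (w.l.o.g.), nontrivial, bad
      (prodBernoulli w).real (openConn a₃ b) ≤ (prodBernoulli w).real (openConn a₁ b) →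
      (prodBernoulli w).real (openConn a₁ b) ≤ (prodBernoulli w).real (openConn a₂ b) →
      (prodBernoulli w).real (openConn o b) < (prodBernoulli w).real (openConn a₃ b) →
      (prodBernoulli w).real (openConn b a₁ ∩ openConn b a₂ ∩ (openConn b a₃)ᶜ) <
        (prodBernoulli w).real (openConn b a₃ ∩ (openConn b a₁)ᶜ ∩ (openConn b a₂)ᶜ) →
      -- the single-exchange charts fail: ¬(G1), ¬(G2)
      (prodBernoulli w).real (openConn o a₁ ∩ (openConn o a₂)ᶜ ∩ (openConn o a₃)ᶜ ∩ openConn a₁ b) + (prodBernoulli w).real ((openConn o a₁ ∪ openConn o a₂ ∪ openConn o a₃)ᶜ ∩ (openConn a₃ b)ᶜ) <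
        (prodBernoulli w).real (openConn o a₁ ∩ (openConn o a₂)ᶜ ∩ (openConn o a₃)ᶜ ∩ openConn a₃ b) →
      (prodBernoulli w).real (openConn o a₂ ∩ (openConn o a₁)ᶜ ∩ (openConn o a₃)ᶜ ∩ openConn a₂ b) + (prodBernoulli w).real ((openConn o a₁ ∪ openConn o a₂ ∪ openConn o a₃)ᶜ ∩ (openConn a₃ b)ᶜ) <
        (prodBernoulli w).real (openConn o a₂ ∩ (openConn o a₁)ᶜ ∩ (openConn o a₃)ᶜ ∩ openConn a₃ b) →
      -- the two-weak-singles charts B, C, D fail (at most one single refined attachment is `≤ 1/2`)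
      ¬ (2 * (prodBernoulli w).real ((openConn a₁ a₂)ᶜ ∩ (openConn a₁ a₃)ᶜ ∩ ((openConn o a₂)ᶜ ∩ (openConn o a₃)ᶜ) ∩ openConn a₁ o) ≤ (prodBernoulli w).real ((openConn a₁ a₂)ᶜ ∩ (openConn a₁ a₃)ᶜ ∩ ((openConn o a₂)ᶜ ∩ (openConn o a₃)ᶜ)) ∧
         2 * (prodBernoulli w).real ((openConn a₂ a₁)ᶜ ∩ (openConn a₂ a₃)ᶜ ∩ ((openConn o a₁)ᶜ ∩ (openConn o a₃)ᶜ) ∩ openConn a₂ o) ≤ (prodBernoulli w).real ((openConn a₂ a₁)ᶜ ∩ (openConn a₂ a₃)ᶜ ∩ ((openConn o a₁)ᶜ ∩ (openConn o a₃)ᶜ))) →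
      ¬ (2 * (prodBernoulli w).real ((openConn a₂ a₁)ᶜ ∩ (openConn a₂ a₃)ᶜ ∩ ((openConn o a₁)ᶜ ∩ (openConn o a₃)ᶜ) ∩ openConn a₂ o) ≤ (prodBernoulli w).real ((openConn a₂ a₁)ᶜ ∩ (openConn a₂ a₃)ᶜ ∩ ((openConn o a₁)ᶜ ∩ (openConn o a₃)ᶜ)) ∧
         2 * (prodBernoulli w).real ((openConn a₃ a₁)ᶜ ∩ (openConn a₃ a₂)ᶜ ∩ ((openConn o a₁)ᶜ ∩ (openConn o a₂)ᶜ) ∩ openConn a₃ o) ≤ (prodBernoulli w).real ((openConn a₃ a₁)ᶜ ∩ (openConn a₃ a₂)ᶜ ∩ ((openConn o a₁)ᶜ ∩ (openConn o a₂)ᶜ))) →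
      ¬ (2 * (prodBernoulli w).real ((openConn a₁ a₂)ᶜ ∩ (openConn a₁ a₃)ᶜ ∩ ((openConn o a₂)ᶜ ∩ (openConn o a₃)ᶜ) ∩ openConn a₁ o) ≤ (prodBernoulli w).real ((openConn a₁ a₂)ᶜ ∩ (openConn a₁ a₃)ᶜ ∩ ((openConn o a₂)ᶜ ∩ (openConn o a₃)ᶜ)) ∧
         2 * (prodBernoulli w).real ((openConn a₃ a₁)ᶜ ∩ (openConn a₃ a₂)ᶜ ∩ ((openConn o a₁)ᶜ ∩ (openConn o a₂)ᶜ) ∩ openConn a₃ o) ≤ (prodBernoulli w).real ((openConn a₃ a₁)ᶜ ∩ (openConn a₃ a₂)ᶜ ∩ ((openConn o a₁)ᶜ ∩ (openConn o a₂)ᶜ))) →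
      -- the Kozma–Nitzan Theorem-2 certificate with room (T1) fails
      ¬ (0 ≤
      (prodBernoulli w).real ((openConn a₁ a₃)ᶜ ∩ (openConn a₂ a₃)ᶜ ∩ (openConn a₁ o ∪ openConn a₂ o)) *
            (prodBernoulli w).real ((openConn a₁ a₂)ᶜ ∩ (openConn a₁ a₃)ᶜ : Set (BondConfig (Fin n))) *
            (prodBernoulli w).real ((openConn a₂ a₁)ᶜ ∩ (openConn a₂ a₃)ᶜ : Set (BondConfig (Fin n))) *
          ((prodBernoulli w).real ((openConn a₁ a₃)ᶜ ∩ (openConn a₂ a₃)ᶜ ∩ (openConn a₁ b ∩ openConn a₂ b)) -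
            (prodBernoulli w).real ((openConn a₁ a₃)ᶜ ∩ (openConn a₂ a₃)ᶜ ∩ openConn a₃ b)) +
        (prodBernoulli w).real ((openConn a₁ a₂)ᶜ ∩ (openConn a₁ a₃)ᶜ ∩ openConn a₁ o) *
            (prodBernoulli w).real ((openConn a₁ a₃)ᶜ ∩ (openConn a₂ a₃)ᶜ : Set (BondConfig (Fin n))) *
            (prodBernoulli w).real ((openConn a₂ a₁)ᶜ ∩ (openConn a₂ a₃)ᶜ : Set (BondConfig (Fin n))) *
          ((prodBernoulli w).real ((openConn a₁ a₂)ᶜ ∩ (openConn a₁ a₃)ᶜ ∩ openConn a₁ b) -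
            (prodBernoulli w).real ((openConn a₁ a₂)ᶜ ∩ (openConn a₁ a₃)ᶜ ∩ (openConn a₂ b ∩ openConn a₃ b))) +
        (prodBernoulli w).real ((openConn a₂ a₁)ᶜ ∩ (openConn a₂ a₃)ᶜ ∩ openConn a₂ o) *
            (prodBernoulli w).real ((openConn a₁ a₃)ᶜ ∩ (openConn a₂ a₃)ᶜ : Set (BondConfig (Fin n))) *
            (prodBernoulli w).real ((openConn a₁ a₂)ᶜ ∩ (openConn a₁ a₃)ᶜ : Set (BondConfig (Fin n))) *
          ((prodBernoulli w).real ((openConn a₂ a₁)ᶜ ∩ (openConn a₂ a₃)ᶜ ∩ openConn a₂ b) -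
            (prodBernoulli w).real ((openConn a₂ a₁)ᶜ ∩ (openConn a₂ a₃)ᶜ ∩ (openConn a₁ b ∩ openConn a₃ b))) +
        (prodBernoulli w).real ((openConn a₁ a₂)ᶜ ∩ (openConn a₁ a₃)ᶜ : Set (BondConfig (Fin n))) *
            (prodBernoulli w).real ((openConn a₂ a₁)ᶜ ∩ (openConn a₂ a₃)ᶜ : Set (BondConfig (Fin n))) *
            (prodBernoulli w).real ((openConn a₁ a₃)ᶜ ∩ (openConn a₂ a₃)ᶜ : Set (BondConfig (Fin n))) *
          (prodBernoulli w).real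
            ((openConn o a₁ ∪ openConn o a₂ ∪ openConn o a₃)ᶜ ∩ (openConn a₃ b)ᶜ : Set (BondConfig (Fin n)))) →
      -- the refined Kozma–Nitzan certificate (source sets with the observer adjoined) fails
      ¬ (0 < (prodBernoulli w).real
          ((openConn a₁ a₃)ᶜ ∩ (openConn a₂ a₃)ᶜ ∩ (openConn o a₃)ᶜ : Set (BondConfig (Fin n))) ∧
        0 < (prodBernoulli w).real
          ((openConn a₁ a₂)ᶜ ∩ (openConn a₁ a₃)ᶜ ∩ ((openConn o a₂)ᶜ ∩ (openConn o a₃)ᶜ) : Set (BondConfig (Fin n))) ∧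
        0 < (prodBernoulli w).real
          ((openConn a₂ a₁)ᶜ ∩ (openConn a₂ a₃)ᶜ ∩ ((openConn o a₁)ᶜ ∩ (openConn o a₃)ᶜ) : Set (BondConfig (Fin n))) ∧
        0 ≤
        (prodBernoulli w).real ((openConn a₁ a₂)ᶜ ∩ (openConn a₁ a₃)ᶜ ∩ ((openConn o a₂)ᶜ ∩ (openConn o a₃)ᶜ) : Set (BondConfig (Fin n)))
          * (prodBernoulli w).real ((openConn a₂ a₁)ᶜ ∩ (openConn a₂ a₃)ᶜ ∩ ((openConn o a₁)ᶜ ∩ (openConn o a₃)ᶜ) : Set (BondConfig (Fin n)))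
          * ((prodBernoulli w).real ((openConn a₁ a₃)ᶜ ∩ (openConn a₂ a₃)ᶜ ∩ (openConn o a₃)ᶜ ∩ (openConn a₁ o ∪ openConn a₂ o))
            * ((prodBernoulli w).real ((openConn a₁ a₃)ᶜ ∩ (openConn a₂ a₃)ᶜ ∩ (openConn o a₃)ᶜ ∩ (openConn a₁ b ∩ openConn a₂ b))
              - (prodBernoulli w).real ((openConn a₁ a₃)ᶜ ∩ (openConn a₂ a₃)ᶜ ∩ (openConn o a₃)ᶜ ∩ openConn a₃ b)))
      + (prodBernoulli w).real ((openConn a₂ a₁)ᶜ ∩ (openConn a₂ a₃)ᶜ ∩ ((openConn o a₁)ᶜ ∩ (openConn o a₃)ᶜ) : Set (BondConfig (Fin n)))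
          * (prodBernoulli w).real ((openConn a₁ a₃)ᶜ ∩ (openConn a₂ a₃)ᶜ ∩ (openConn o a₃)ᶜ : Set (BondConfig (Fin n)))
          * ((prodBernoulli w).real ((openConn a₁ a₂)ᶜ ∩ (openConn a₁ a₃)ᶜ ∩ ((openConn o a₂)ᶜ ∩ (openConn o a₃)ᶜ) ∩ openConn a₁ o)
            * ((prodBernoulli w).real ((openConn a₁ a₂)ᶜ ∩ (openConn a₁ a₃)ᶜ ∩ ((openConn o a₂)ᶜ ∩ (openConn o a₃)ᶜ) ∩ openConn a₁ b)
              - (prodBernoulli w).real ((openConn a₁ a₂)ᶜ ∩ (openConn a₁ a₃)ᶜ ∩ ((openConn o a₂)ᶜ ∩ (openConn o a₃)ᶜ) ∩ (openConn a₂ b ∩ openConn a₃ b))))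
      + (prodBernoulli w).real ((openConn a₁ a₂)ᶜ ∩ (openConn a₁ a₃)ᶜ ∩ ((openConn o a₂)ᶜ ∩ (openConn o a₃)ᶜ) : Set (BondConfig (Fin n)))
          * (prodBernoulli w).real ((openConn a₁ a₃)ᶜ ∩ (openConn a₂ a₃)ᶜ ∩ (openConn o a₃)ᶜ : Set (BondConfig (Fin n)))
          * ((prodBernoulli w).real ((openConn a₂ a₁)ᶜ ∩ (openConn a₂ a₃)ᶜ ∩ ((openConn o a₁)ᶜ ∩ (openConn o a₃)ᶜ) ∩ openConn a₂ o)
            * ((prodBernoulli w).real ((openConn a₂ a₁)ᶜ ∩ (openConn a₂ a₃)ᶜ ∩ ((openConn o a₁)ᶜ ∩ (openConn o a₃)ᶜ) ∩ openConn a₂ b)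
              - (prodBernoulli w).real ((openConn a₂ a₁)ᶜ ∩ (openConn a₂ a₃)ᶜ ∩ ((openConn o a₁)ᶜ ∩ (openConn o a₃)ᶜ) ∩ (openConn a₁ b ∩ openConn a₃ b))))) →
      (prodBernoulli w).real ((openConn o a₁ ∪ openConn o a₂ ∪ openConn o a₃) \ openConn o b) ≤
        (prodBernoulli w).real ((openConn a₃ b)ᶜ)) :
    ∀ (n : ℕ) (w : Sym2 (Fin n) → unitInterval) (o b a₁ a₂ a₃ : Fin n) (t : ℝ),
      a₁ ≠ a₂ → a₁ ≠ a₃ → a₂ ≠ a₃ →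
      1 - t ≤ (prodBernoulli w).real (openConn a₃ b) →
      (prodBernoulli w).real (openConn a₃ b) ≤ (prodBernoulli w).real (openConn a₁ b) →
      (prodBernoulli w).real (openConn a₃ b) ≤ (prodBernoulli w).real (openConn a₂ b) →
      (prodBernoulli w).real ((openConn o a₁ ∪ openConn o a₂ ∪ openConn o a₃) \ openConn o b) ≤ t := by
  intro n w o b a₁ a₂ a₃ t h12 h13 h23 hτ3 hτ31 hτ32
  have hm : ∀ s : Set (BondConfig (Fin n)), MeasurableSet s := fun _ => MeasurableSet.of_discrete
  have hc3 : (prodBernoulli w).real ((openConn a₃ b)ᶜ : Set (BondConfig (Fin n))) =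
      1 - (prodBernoulli w).real (openConn a₃ b : Set (BondConfig (Fin n))) := probReal_compl_eq_one_sub (hm _)
  suffices hE : (prodBernoulli w).real ((openConn o a₁ ∪ openConn o a₂ ∪ openConn o a₃) \ openConn o b) ≤
      (prodBernoulli w).real ((openConn a₃ b)ᶜ : Set (BondConfig (Fin n))) by linarith
  -- trivial region (this also disposes of `o ∈ {a₁, a₂, a₃}`)
  by_cases hob : (prodBernoulli w).real (openConn a₃ b) ≤ (prodBernoulli w).real (openConn o b)
  · have hco : (prodBernoulli w).real ((openConn o b)ᶜ : Set (BondConfig (Fin n))) =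
        1 - (prodBernoulli w).real (openConn o b : Set (BondConfig (Fin n))) := probReal_compl_eq_one_sub (hm _)
    have hsub : (prodBernoulli w).real ((openConn o a₁ ∪ openConn o a₂ ∪ openConn o a₃) \ openConn o b) ≤
        (prodBernoulli w).real ((openConn o b)ᶜ : Set (BondConfig (Fin n))) :=
      measureReal_mono (fun ω hω => hω.2)
    linarith
  push Not at hob
  have ho1 : o ≠ a₁ := by rintro rfl; linarith
  have ho2 : o ≠ a₂ := by rintro rfl; linarith
  have ho3 : o ≠ a₃ := by rintro rfl; linarith
  by_cases hτ12 : (prodBernoulli w).real (openConn a₁ b) ≤ (prodBernoulli w).real (openConn a₂ b)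
  · exact eform3_of_residual_ordered hRES w o b a₁ a₂ a₃ h12 h13 h23 ho1 ho2 ho3 hτ31 hτ32 hτ12
  · push Not at hτ12
    have hu : (openConn o a₂ ∪ openConn o a₁ ∪ openConn o a₃ : Set (BondConfig (Fin n))) =
        (openConn o a₁ ∪ openConn o a₂ ∪ openConn o a₃) := by rw [Set.union_comm (openConn o a₂)]
    have h := eform3_of_residual_ordered hRES w o b a₂ a₁ a₃ h12.symm h23 h13 ho2 ho1 ho3 hτ32 hτ31 hτ12.le
    rw [hu] at h
    exact h

end

end Summit.CriticalPhenomena.PercolationContinuityZ3.Theorems
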